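/-
Copyright (c) 2026 the pub-hodgecm-mathlib formalisation cell (harness21).  Prover seat hodgecm-mathlib-LH4-p09 (g8), req620 Track A «(D-RAM) FOUR-FRAME» squad
(heir dealer LH4-plan (g13) WORD #58 RULING C — first refusal: labelled κ-counts on the glued + core-hanging strata; (T-G-on) claimed 11:20Z).  2026-09-04.
-/
import Summits.HodgeConjecture.HodgeConjecture.Theorems.F0P3cDyRamDiagonalKappaCoreHangingSocket        -- ★ κH socket (LH4-p06 (g3)): `finsum_kappaCount_mul_stabiliserWeight_orbit_eq`, `finite_orbit`, `…_hasAxis_H`; brings ★ κH-B1 character sums, ★ B7 (C)∕(D1)∕(D2)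
import Summits.HodgeConjecture.HodgeConjecture.Theorems.F0P3cDyRamLabelledCoreHangingLocusCensusClosed  -- ★ p859628 (this seat): `latticeInLevel_diagonal_latt_coreHanging_iff_onLocus`, `tokenBall_unit_of_le`, `v_one_add_eq_one_of_ball`, `v_one_add_lt_one_of_ball`
import HarnessLib

/-!
# (D-RAM) four-frame, STAGE 1b — (S2b-κS) organ (T-G-on | H): the LABELLED κ-COUNT on the core-hanging stratum `H (2ρ, 2ρ, 2ρ)` ON THE CANCELLATION LOCUS
# `|e₂ − e₁| = |e₂ − e₀|` — `R`-currency (character sums over the token ball) and the vacuous regime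

Helper brick for dealer LH4-plan (g13) WORD #58 RULING C («(S2b-κS) … LH4-p09 (g8) FIRST REFUSAL on the glued + core-hanging strata»; labour split 11:20Z: (T-G-on) =
this seat): `Theorems/` only, statement-first, ★-only imports, lane `--supports stmt-HodgeConjecture-24833 --as helper`; it PAYS NO tier-0 row (count-neutral).  ONE
statement shape with LH4-p12 (g7)'s off-locus one-token sockets `finsum_kappaCount_mul_stabiliserWeight_stratum_H_sep_latticeInLevel_of_ne` (binders `(ρ) (hρ) … (ℓ) (e)`,
`(k) (hk) (hloc)` in place of `(hne)`).

WHY IT MATTERS.  For the token of record `e = ((α−1)², (β−1)², 0)` the H strata of an equilateral datum are ALL on the locus (`v(e₂−e₁) = v(e₂−e₀) = 2m`), so the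
labelled trunk (★ p859650 `hTrunk`) cannot be fed by the off-locus socket there.

THE PICTURE (κ-twin of this seat's ★ p859619).  On the locus the token is `[outer] ∧ |ϖ|^k·|κ + g_e| ≤ |ϖ|^{ℓ+2ρ}` on the glue invariant `κ` (★ p859628 §1), a class
condition; ★ B7 decomposes the stratum into unit-torus orbits over the admissible representatives (tube, ★ (C)) ∕ the stability ball (equilateral foot, ★ (D2)); on the
orbit of `V(1,1,g)` the κ-weighted mass is `[2d−1 ≤ ρ]·χᴴᵢ(g) · |orbit|·w` (★ κH `finsum_kappaCount_mul_stabiliserWeight_orbit_eq`, `χᴴᵢ(g) = (ω(−(1+g)), ω(g)ω(−(1+g)), ω(g))ᵢ`).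
So the label-cut κ-sum is a CHARACTER SUM over the token ball:
* §1 **`finsum_kappaCount_mul_stabiliserWeight_stratum_H_sep_onLocus_tube_eq`** (`2ρ ≤ n₁, n₂`, `ρ ≤ n₃`):
  `Σᶠ_{M ∈ H, diag(e)M ⊆ ϖ^ℓM} κᵢ(M)·w(M) = [outer] · q^{ρ+⌊ρ∕2⌋} · Σᶠ_{g ∈ R, |1+g| = 1, |ϖ|^k·|g+g_e| ≤ |ϖ|^{ℓ+2ρ}} [2d−1 ≤ ρ]·χᴴᵢ(g)`;
  **`…_onLocus_foot_eq`** (`n₁ = n₂ = n₃ = m`, `ρ ≤ m < 2ρ`): index set `{g ∈ R : |g + g₀| ≤ |ϖ|^{2ρ−m} ∧ token ball}`.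
* §2 **`finsum_kappaCount_mul_stabiliserWeight_stratum_H_sep_eq_of_vacuous`** — in the VACUOUS regime `ℓ + 2ρ ≤ k` (with the outer reads) the label cuts nothing:
  the label-cut κ-sum IS ★ κH `finsum_kappaCount_mul_stabiliserWeight_hasAxis_H` (value verbatim, `f₀` binder verbatim) — any regime of the datum.
The genuine-regime closed forms (★ κH-B1 `finsum_chiH_glue_eq_ncard_mul ∕ _eq_zero` over the token ball, admissible iff `|e₁−e₀| = |ϖ|^k`; on the equilateral foot two
balls, nested iff a common fixed point — for `e` of record the centres `−g₀`, `−g₀²` are at distance `1`, so the genuine foot regime is EMPTY) are the next file.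

HONEST LABEL: helper organs for a HYPOTHESIS (hTrunk); STAGE-1b tier-0 rows T₊∕T₋∕regular and the six ED. 5 stubs stay OPEN; HC_CM is proved only modulo the 7
printed citations (2 remaining named inputs: hLiu418 = `stmt-HodgeConjecture-24832`, h413 = `stmt-HodgeConjecture-24833`) until rung 0 closes.

## References
* [Kottwitz1986BaseChangeUnits] R. E. Kottwitz, *Base change for unit elements of Hecke algebras*, Compositio Math. 60 (1986), §1 pp. 240–241 (κ-orbital integrals of units as signed lattice counts modulo the torus).
* [LanglandsShelstad1987] R. P. Langlands, D. Shelstad, *On the definition of transfer factors*, Math. Ann. 278 (1987), §3 (κ as a character).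
* [Rogawski1990] J. D. Rogawski, *Automorphic Representations of Unitary Groups in Three Variables*, Ann. of Math. Stud. 123 (1990), §4.9 Prop. 4.9.1 (a) p. 55.
-/

set_option autoImplicit false

noncomputable section

namespace Summit.HodgeConjecture.HodgeConjecture.Cruxes.H413.F0P3cDyRamLabelledKappaCoreHangingLocus

open Matrix WithZero
open Literature.NumberTheory.Automorphic Literature.NumberTheory.Automorphic.HermitianLattice Literature.NumberTheory.Automorphic.UnitaryGroup
open Literature.NumberTheory.Automorphic.UnitaryLatticeTree Literature.NumberTheory.Automorphic.UnitaryThreeFourFrame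
open Literature.NumberTheory.LocalFields.WildQuadraticDatum
open Summit.HodgeConjecture.HodgeConjecture.Cruxes.H413.F0P3cDyRamDiagonalTorusDefs
open Summit.HodgeConjecture.HodgeConjecture.Cruxes.H413.F0P3cDyRamDiagonalStrataDefs
open Summit.HodgeConjecture.HodgeConjecture.Cruxes.H413.F0P3cDyRamDiagonalKappaCountDefs
open Summit.HodgeConjecture.HodgeConjecture.Cruxes.H413.F0P3cDyRamDiagonalGluedTorusOrbits (exists_gl_coe_eq_glued)
open Summit.HodgeConjecture.HodgeConjecture.Cruxes.H413.F0P3cDyRamDiagonalGluedStabiliserIndex (ne_zero_and_v_lt_one_of_v_eq_exp)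
open Summit.HodgeConjecture.HodgeConjecture.Cruxes.H413.F0P3cDyRamDiagonalCoreHangingOrbits (exists_coreHanging_of_mem_orbit)
open Summit.HodgeConjecture.HodgeConjecture.Cruxes.H413.F0P3cDyRamDiagonalCoreHangingCount
open Summit.HodgeConjecture.HodgeConjecture.Cruxes.H413.F0P3cDyRamDiagonalCoreHangingGlueCount
open Summit.HodgeConjecture.HodgeConjecture.Cruxes.H413.F0P3cDyRamDiagonalCoreHangingSocket (stratum_H_eq)
open Summit.HodgeConjecture.HodgeConjecture.Cruxes.H413.F0P3cDyRamDiagonalKappaCoreHangingSocket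
open Summit.HodgeConjecture.HodgeConjecture.Cruxes.H413.F0P3cDyRamElementDatumParity (isoceles_of_isElementDatum)
open Summit.HodgeConjecture.HodgeConjecture.Cruxes.H413.F0P3cDyRamFourFrameCensusDefs
open Summit.HodgeConjecture.HodgeConjecture.Cruxes.H413.F0P3cDyRamLabelledGluedClassCut (orbit_mul_weight_eq)
open Summit.HodgeConjecture.HodgeConjecture.Cruxes.H413.F0P3cDyRamLabelledSplitStrata (finsum_mem_sep_eq_ite_of_forall_iff)
open Summit.HodgeConjecture.HodgeConjecture.Cruxes.H413.F0P3cDyRamLabelledCoreHangingLocusCensus (latticeInLevel_diagonal_latt_coreHanging_iff_onLocus tokenBall_unit_of_le)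
open scoped Valued WithZero Matrix MatrixGroups

/-! ## §1  The on-locus labelled κ-count of H in `R`-currency: character sums over the token ball -/

section Census

variable {K : Type} [Field K] [Valued K ℤᵐ⁰] [CompleteSpace K] [Fintype 𝓀[K]] {σ : K →+* K} {ϖ : K} {d t : ℕ} {α β : K} {N₀ n₁ n₂ n₃ : ℕ}
  {T : GL (Fin 3) K}

open Classical in
/-- **HEAD (TUBE, `R`-CURRENCY) — THE LABELLED κ-WEIGHTED H SUM ON THE LOCUS** (`2ρ ≤ n₁, n₂`, `ρ ≤ n₃`; `v(e₂−e₀) = v(e₂−e₁) = k`): for any irredundant complete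
system `R` of the `σ`-fixed units modulo `𝔭^ρ`,
`Σᶠ_{M ∈ H, diag(e)M ⊆ ϖ^ℓM} κᵢ(M)·w(M) = [outer] · (Σᶠ_{g ∈ R, |1+g| = 1, |ϖ|^k·|g+g_e| ≤ |ϖ|^{ℓ+2ρ}} [2d−1 ≤ ρ]·χᴴᵢ(g)) · q^{ρ+⌊ρ∕2⌋}` — ★ B7 `stratum_H_eq` + ★ (C)
`coreHangingStratum_eq_iUnion_orbits`, the token constant on each orbit (★ p859628 §1 + ★ `exists_coreHanging_of_mem_orbit`), ★ κH `finsum_kappaCount_mul_stabiliserWeight_orbit_eq`.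
[cite: Kottwitz1986BaseChangeUnits, §1 pp. 240–241] [cite: LanglandsShelstad1987, §3] [cite: Rogawski1990, §4.9 Prop. 4.9.1 (a) p. 55] -/
theorem finsum_kappaCount_mul_stabiliserWeight_stratum_H_sep_onLocus_tube_eq (hD : IsRamifiedQuadraticDatum σ ϖ d t) (h2 : Valued.v (2 : K) < 1)
    (hE : IsElementDatum σ ϖ N₀ α β n₁ n₂ n₃) (hT : (T : Matrix (Fin 3) (Fin 3) K) = Matrix.diagonal ![α, β, 1])
    (ρ : ℕ) (hρ : 1 ≤ ρ) (htube : 2 * ρ ≤ n₁ ∧ 2 * ρ ≤ n₂) (hn₃ : ρ ≤ n₃) (i : Fin 3) (ℓ k : ℕ) (e : Fin 3 → K)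
    (hk : Valued.v (e 2 - e 0) = Valued.v ϖ ^ k) (hloc : Valued.v (e 2 - e 1) = Valued.v ϖ ^ k) {R : Set K} (hRfin : R.Finite)
    (hR1 : ∀ g ∈ R, σ g = g ∧ Valued.v g = 1) (hR2 : ∀ f : K, σ f = f → Valued.v f = 1 → ∃ g ∈ R, Valued.v (f - g) ≤ Valued.v ϖ ^ ρ)
    (hR3 : ∀ g ∈ R, ∀ g' ∈ R, Valued.v (g - g') ≤ Valued.v ϖ ^ ρ → g = g') :
    ∑ᶠ M ∈ {M | M ∈ stratum σ ϖ T ![2 * ρ, 2 * ρ, 2 * ρ] ∧ LatticeInLevel ϖ ℓ (Matrix.diagonal e) M},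
        (kappaCount σ ϖ 0 i M : ℚ) * stabiliserWeight σ M =
      if ((Valued.v (e 0) ≤ Valued.v ϖ ^ ℓ ∧ Valued.v (e 1) ≤ Valued.v ϖ ^ ℓ ∧ Valued.v (e 2) ≤ Valued.v ϖ ^ ℓ) ∧
          Valued.v (e 1 - e 0) ≤ Valued.v ϖ ^ (ℓ + ρ)) ∧ ℓ + ρ ≤ k then
        (∑ᶠ g ∈ {g : K | g ∈ R ∧ Valued.v (1 + g) = 1 ∧ Valued.v ϖ ^ k * Valued.v (g + (e 2 - e 1) / (e 2 - e 0)) ≤ Valued.v ϖ ^ (ℓ + 2 * ρ)},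
            (((if 2 * d - 1 ≤ ρ then (![normSign σ (-(1 + g)), normSign σ g * normSign σ (-(1 + g)), normSign σ g] : Fin 3 → ℤ) i else 0) : ℤ) : ℚ)) *
          (Fintype.card 𝓀[K] : ℚ) ^ (ρ + ρ / 2)
      else 0 := by
  classical
  have hTr := trace_bound_of_isRamifiedQuadraticDatum hD h2
  obtain ⟨hσ, hvσ, hϖ, hfix, hd, -, -⟩ := id hD
  obtain ⟨hαn, hβn, -, -, -, h₁, h₂, h₃, -, -, -⟩ := hE
  have hα := UnitaryThreeFourFrame.v_eq_one_of_mul_map_eq_one hvσ hαn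
  have hβ := UnitaryThreeFourFrame.v_eq_one_of_mul_map_eq_one hvσ hβn
  have h₃' : Valued.v (β - α) = Valued.v ϖ ^ n₃ := by rw [Valuation.map_sub_swap, h₃]
  obtain ⟨hϖ0, hϖ1⟩ := ne_zero_and_v_lt_one_of_v_eq_exp hϖ
  have hq : 1 < Nat.card 𝓀[K] := Finite.one_lt_card
  have hpρ : ϖ ^ ρ ≠ 0 := pow_ne_zero ρ hϖ0
  have hpr : ϖ ^ (2 * ρ) ≠ 0 := pow_ne_zero _ hϖ0
  set Orb : K → Set (Submodule 𝒪[K] (Fin 3 → K)) := fun g =>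
    {M | ∃ u ∈ unitTorus K 3, M = mapGL (diagGLUnits u) (latt (!![1, 0, 0; 1, ϖ ^ ρ, 0; 1 * 1 + g, ϖ ^ ρ * 1, ϖ ^ (2 * ρ)] : Matrix (Fin 3) (Fin 3) K))}
    with hOrb
  have hread : ∀ g ∈ R, Valued.v (1 + g) = 1 → ∀ M ∈ Orb g, (LatticeInLevel ϖ ℓ (Matrix.diagonal e) M ↔
      (((Valued.v (e 0) ≤ Valued.v ϖ ^ ℓ ∧ Valued.v (e 1) ≤ Valued.v ϖ ^ ℓ ∧ Valued.v (e 2) ≤ Valued.v ϖ ^ ℓ) ∧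
          Valued.v (e 1 - e 0) ≤ Valued.v ϖ ^ (ℓ + ρ)) ∧ ℓ + ρ ≤ k) ∧
        Valued.v ϖ ^ k * Valued.v (g + (e 2 - e 1) / (e 2 - e 0)) ≤ Valued.v ϖ ^ (ℓ + 2 * ρ)) := by
    rintro g hg h1g M ⟨u, hu, rfl⟩
    obtain ⟨V₀, hV₀⟩ := exists_gl_coe_eq_glued (1 : K) 1 g hpρ hpr
    obtain ⟨x', ζ', y₁, hx', hζ', -, -, hκ, hM⟩ := exists_coreHanging_of_mem_orbit u hu (hR1 g hg).2 h1g (ϖ ^ ρ) (ϖ ^ (2 * ρ)) V₀ hV₀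
    rw [← hV₀, hM, latticeInLevel_diagonal_latt_coreHanging_iff_onLocus hϖ ℓ ρ k e hk hloc hx' hζ' y₁, hκ]
  have hdec := coreHangingStratum_eq_iUnion_orbits hσ hvσ hϖ hTr T hT hα hβ h₁ h₂ h₃' hρ htube.1 htube.2 hn₃ hR1 hR2
  have hconst := orbit_mul_weight_eq hq hρ 0
  simp only [Nat.mul_zero, Nat.add_zero] at hconst
  rw [← Nat.card_eq_fintype_card]
  by_cases hout : ((Valued.v (e 0) ≤ Valued.v ϖ ^ ℓ ∧ Valued.v (e 1) ≤ Valued.v ϖ ^ ℓ ∧ Valued.v (e 2) ≤ Valued.v ϖ ^ ℓ) ∧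
      Valued.v (e 1 - e 0) ≤ Valued.v ϖ ^ (ℓ + ρ)) ∧ ℓ + ρ ≤ k
  · rw [if_pos hout]
    set S : Set K := {g : K | g ∈ R ∧ Valued.v (1 + g) = 1 ∧ Valued.v ϖ ^ k * Valued.v (g + (e 2 - e 1) / (e 2 - e 0)) ≤ Valued.v ϖ ^ (ℓ + 2 * ρ)}
      with hS
    have hSfin : S.Finite := hRfin.subset (fun g hg => hg.1)
    have hset : {M | M ∈ stratum σ ϖ T ![2 * ρ, 2 * ρ, 2 * ρ] ∧ LatticeInLevel ϖ ℓ (Matrix.diagonal e) M} = ⋃ g ∈ S, Orb g := by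
      ext M
      rw [Set.mem_setOf_eq, stratum_H_eq hvσ hfix hϖ T hρ, hdec, Set.mem_iUnion₂, Set.mem_iUnion₂]
      constructor
      · rintro ⟨⟨g, hg, hMg⟩, hL⟩
        exact ⟨g, ⟨hg.1, hg.2, ((hread g hg.1 hg.2 M hMg).1 hL).2⟩, hMg⟩
      · rintro ⟨g, hg, hMg⟩
        exact ⟨⟨g, ⟨hg.1, hg.2.1⟩, hMg⟩, (hread g hg.1 hg.2.1 M hMg).2 ⟨hout, hg.2.2⟩⟩
    rw [hset, finsum_mem_biUnion (pairwise_disjoint_orbits_of hϖ ρ (fun g hg => hg.1) (fun g hg => (hR1 g hg).2) (fun g hg => hg.2.1) hR3)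
        hSfin (fun g hg => finite_orbit hϖ hρ (hR1 g hg.1).2),
      finsum_mem_congr rfl (fun g hg => finsum_kappaCount_mul_stabiliserWeight_orbit_eq hD h2 hρ (hR1 g hg.1).1 (hR1 g hg.1).2 hg.2.1 i),
      ← finsum_mem_mul, hconst]
  · rw [if_neg hout]
    have hset : {M | M ∈ stratum σ ϖ T ![2 * ρ, 2 * ρ, 2 * ρ] ∧ LatticeInLevel ϖ ℓ (Matrix.diagonal e) M} = ∅ :=
      Set.eq_empty_of_forall_notMem fun M ⟨hM, hL⟩ => by
        rw [stratum_H_eq hvσ hfix hϖ T hρ, hdec, Set.mem_iUnion₂] at hM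
        obtain ⟨g, hg, hMg⟩ := hM
        exact hout ((hread g hg.1 hg.2 M hMg).1 hL).1
    rw [hset, finsum_mem_empty]

open Classical in
/-- **HEAD (FOOT, `R`-CURRENCY) — THE LABELLED κ-WEIGHTED H SUM ON THE LOCUS** (equilateral foot `n₁ = n₂ = n₃ = m`, `ρ ≤ m < 2ρ`; `v(e₂−e₀) = v(e₂−e₁) = k`;
`g₀ = (β−1)∕(α−1)`): `Σᶠ_{M ∈ H, diag(e)M ⊆ ϖ^ℓM} κᵢ(M)·w(M) = [outer] · (Σᶠ_{g ∈ R, |g+g₀| ≤ |ϖ|^{2ρ−m}, token ball} [2d−1 ≤ ρ]·χᴴᵢ(g)) · q^{ρ+⌊ρ∕2⌋}` (★ (D2)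
`coreHangingStratum_eq_iUnion_orbits_glue`; admissibility automatic on the stability ball). [cite: Kottwitz1986BaseChangeUnits, §1 pp. 240–241] [cite: LanglandsShelstad1987, §3]
[cite: Rogawski1990, §4.9 Prop. 4.9.1 (a) p. 55] -/
theorem finsum_kappaCount_mul_stabiliserWeight_stratum_H_sep_onLocus_foot_eq (hD : IsRamifiedQuadraticDatum σ ϖ d t) (h2 : Valued.v (2 : K) < 1)
    (hE : IsElementDatum σ ϖ N₀ α β n₁ n₂ n₃) (hT : (T : Matrix (Fin 3) (Fin 3) K) = Matrix.diagonal ![α, β, 1])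
    (ρ : ℕ) (hρ : 1 ≤ ρ) (h12 : n₁ = n₂) (h13 : n₁ = n₃) (hρm : ρ ≤ n₁) (hm : n₁ < 2 * ρ) (i : Fin 3) (ℓ k : ℕ) (e : Fin 3 → K)
    (hk : Valued.v (e 2 - e 0) = Valued.v ϖ ^ k) (hloc : Valued.v (e 2 - e 1) = Valued.v ϖ ^ k) {R : Set K} (hRfin : R.Finite)
    (hR1 : ∀ g ∈ R, σ g = g ∧ Valued.v g = 1) (hR2 : ∀ f : K, σ f = f → Valued.v f = 1 → ∃ g ∈ R, Valued.v (f - g) ≤ Valued.v ϖ ^ ρ)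
    (hR3 : ∀ g ∈ R, ∀ g' ∈ R, Valued.v (g - g') ≤ Valued.v ϖ ^ ρ → g = g') :
    ∑ᶠ M ∈ {M | M ∈ stratum σ ϖ T ![2 * ρ, 2 * ρ, 2 * ρ] ∧ LatticeInLevel ϖ ℓ (Matrix.diagonal e) M},
        (kappaCount σ ϖ 0 i M : ℚ) * stabiliserWeight σ M =
      if ((Valued.v (e 0) ≤ Valued.v ϖ ^ ℓ ∧ Valued.v (e 1) ≤ Valued.v ϖ ^ ℓ ∧ Valued.v (e 2) ≤ Valued.v ϖ ^ ℓ) ∧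
          Valued.v (e 1 - e 0) ≤ Valued.v ϖ ^ (ℓ + ρ)) ∧ ℓ + ρ ≤ k then
        (∑ᶠ g ∈ {g : K | g ∈ R ∧ Valued.v (g + (β - 1) / (α - 1)) ≤ Valued.v ϖ ^ (2 * ρ - n₁) ∧
              Valued.v ϖ ^ k * Valued.v (g + (e 2 - e 1) / (e 2 - e 0)) ≤ Valued.v ϖ ^ (ℓ + 2 * ρ)},
            (((if 2 * d - 1 ≤ ρ then (![normSign σ (-(1 + g)), normSign σ g * normSign σ (-(1 + g)), normSign σ g] : Fin 3 → ℤ) i else 0) : ℤ) : ℚ)) *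
          (Fintype.card 𝓀[K] : ℚ) ^ (ρ + ρ / 2)
      else 0 := by
  classical
  have hTr := trace_bound_of_isRamifiedQuadraticDatum hD h2
  obtain ⟨hσ, hvσ, hϖ, hfix, hd, -, -⟩ := id hD
  obtain ⟨hαn, hβn, -, -, -, h₁, h₂, h₃, -, -, -⟩ := hE
  subst h12 h13
  have hα := UnitaryThreeFourFrame.v_eq_one_of_mul_map_eq_one hvσ hαn
  have hβ := UnitaryThreeFourFrame.v_eq_one_of_mul_map_eq_one hvσ hβn
  have h₃' : Valued.v (β - α) = Valued.v ϖ ^ n₁ := by rw [Valuation.map_sub_swap, h₃]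
  obtain ⟨hϖ0, hϖ1⟩ := ne_zero_and_v_lt_one_of_v_eq_exp hϖ
  have hq : 1 < Nat.card 𝓀[K] := Finite.one_lt_card
  have hpρ : ϖ ^ ρ ≠ 0 := pow_ne_zero ρ hϖ0
  have hpr : ϖ ^ (2 * ρ) ≠ 0 := pow_ne_zero _ hϖ0
  have hadm : ∀ {g : K}, Valued.v (g + (β - 1) / (α - 1)) ≤ Valued.v ϖ ^ (2 * ρ - n₁) → Valued.v (1 + g) = 1 :=
    fun hg => v_one_add_eq_one_of_glue hϖ h₂ h₃' (by omega) hg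
  set Orb : K → Set (Submodule 𝒪[K] (Fin 3 → K)) := fun g =>
    {M | ∃ u ∈ unitTorus K 3, M = mapGL (diagGLUnits u) (latt (!![1, 0, 0; 1, ϖ ^ ρ, 0; 1 * 1 + g, ϖ ^ ρ * 1, ϖ ^ (2 * ρ)] : Matrix (Fin 3) (Fin 3) K))}
    with hOrb
  have hread : ∀ g ∈ R, Valued.v (1 + g) = 1 → ∀ M ∈ Orb g, (LatticeInLevel ϖ ℓ (Matrix.diagonal e) M ↔
      (((Valued.v (e 0) ≤ Valued.v ϖ ^ ℓ ∧ Valued.v (e 1) ≤ Valued.v ϖ ^ ℓ ∧ Valued.v (e 2) ≤ Valued.v ϖ ^ ℓ) ∧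
          Valued.v (e 1 - e 0) ≤ Valued.v ϖ ^ (ℓ + ρ)) ∧ ℓ + ρ ≤ k) ∧
        Valued.v ϖ ^ k * Valued.v (g + (e 2 - e 1) / (e 2 - e 0)) ≤ Valued.v ϖ ^ (ℓ + 2 * ρ)) := by
    rintro g hg h1g M ⟨u, hu, rfl⟩
    obtain ⟨V₀, hV₀⟩ := exists_gl_coe_eq_glued (1 : K) 1 g hpρ hpr
    obtain ⟨x', ζ', y₁, hx', hζ', -, -, hκ, hM⟩ := exists_coreHanging_of_mem_orbit u hu (hR1 g hg).2 h1g (ϖ ^ ρ) (ϖ ^ (2 * ρ)) V₀ hV₀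
    rw [← hV₀, hM, latticeInLevel_diagonal_latt_coreHanging_iff_onLocus hϖ ℓ ρ k e hk hloc hx' hζ' y₁, hκ]
  have hdec := coreHangingStratum_eq_iUnion_orbits_glue hσ hvσ hϖ hTr T hT hα hβ h₁ h₂ h₃' hρ hρm hm hR1 hR2
  have hconst := orbit_mul_weight_eq hq hρ 0
  simp only [Nat.mul_zero, Nat.add_zero] at hconst
  rw [← Nat.card_eq_fintype_card]
  by_cases hout : ((Valued.v (e 0) ≤ Valued.v ϖ ^ ℓ ∧ Valued.v (e 1) ≤ Valued.v ϖ ^ ℓ ∧ Valued.v (e 2) ≤ Valued.v ϖ ^ ℓ) ∧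
      Valued.v (e 1 - e 0) ≤ Valued.v ϖ ^ (ℓ + ρ)) ∧ ℓ + ρ ≤ k
  · rw [if_pos hout]
    set S : Set K := {g : K | g ∈ R ∧ Valued.v (g + (β - 1) / (α - 1)) ≤ Valued.v ϖ ^ (2 * ρ - n₁) ∧
      Valued.v ϖ ^ k * Valued.v (g + (e 2 - e 1) / (e 2 - e 0)) ≤ Valued.v ϖ ^ (ℓ + 2 * ρ)} with hS
    have hSfin : S.Finite := hRfin.subset (fun g hg => hg.1)
    have hset : {M | M ∈ stratum σ ϖ T ![2 * ρ, 2 * ρ, 2 * ρ] ∧ LatticeInLevel ϖ ℓ (Matrix.diagonal e) M} = ⋃ g ∈ S, Orb g := by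
      ext M
      rw [Set.mem_setOf_eq, stratum_H_eq hvσ hfix hϖ T hρ, hdec, Set.mem_iUnion₂, Set.mem_iUnion₂]
      constructor
      · rintro ⟨⟨g, hg, hMg⟩, hL⟩
        exact ⟨g, ⟨hg.1, hg.2, ((hread g hg.1 (hadm hg.2) M hMg).1 hL).2⟩, hMg⟩
      · rintro ⟨g, hg, hMg⟩
        exact ⟨⟨g, ⟨hg.1, hg.2.1⟩, hMg⟩, (hread g hg.1 (hadm hg.2.1) M hMg).2 ⟨hout, hg.2.2⟩⟩
    rw [hset, finsum_mem_biUnion (pairwise_disjoint_orbits_of hϖ ρ (fun g hg => hg.1) (fun g hg => (hR1 g hg).2) (fun g hg => hadm hg.2.1) hR3)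
        hSfin (fun g hg => finite_orbit hϖ hρ (hR1 g hg.1).2),
      finsum_mem_congr rfl (fun g hg => finsum_kappaCount_mul_stabiliserWeight_orbit_eq hD h2 hρ (hR1 g hg.1).1 (hR1 g hg.1).2 (hadm hg.2.1) i),
      ← finsum_mem_mul, hconst]
  · rw [if_neg hout]
    have hset : {M | M ∈ stratum σ ϖ T ![2 * ρ, 2 * ρ, 2 * ρ] ∧ LatticeInLevel ϖ ℓ (Matrix.diagonal e) M} = ∅ :=
      Set.eq_empty_of_forall_notMem fun M ⟨hM, hL⟩ => by
        rw [stratum_H_eq hvσ hfix hϖ T hρ, hdec, Set.mem_iUnion₂] at hM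
        obtain ⟨g, hg, hMg⟩ := hM
        exact hout ((hread g hg.1 (hadm hg.2) M hMg).1 hL).1
    rw [hset, finsum_mem_empty]

end Census

/-! ## §2  The vacuous regime: the label cuts nothing -/

section Vacuous

variable {K : Type} [Field K] [Valued K ℤᵐ⁰] [CompleteSpace K] [Fintype 𝓀[K]] {σ : K →+* K} {ϖ : K} {d t : ℕ} {α β : K} {N₀ n₁ n₂ n₃ : ℕ}
  {T : GL (Fin 3) K}

omit [CompleteSpace K] [Fintype 𝓀[K]] in
/-- **IN THE VACUOUS REGIME THE TOKEN HOLDS ON THE WHOLE H STRATUM**: on the locus `v(e₂−e₀) = v(e₂−e₁) = k` with the outer reads and `ℓ + 2ρ ≤ k`, every member of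
`H (2ρ, 2ρ, 2ρ)` carries the token (★ `stratum_H_eq` normal form, ★ p859628 read, `tokenBall_unit_of_le` on the unit `κ`). [cite: Kottwitz1986BaseChangeUnits, §1 pp. 240–241] -/
theorem latticeInLevel_of_mem_stratum_H_of_vacuous (hD : IsRamifiedQuadraticDatum σ ϖ d t) (T : GL (Fin 3) K) (ρ : ℕ) (hρ : 1 ≤ ρ) (ℓ k : ℕ)
    (e : Fin 3 → K) (hk : Valued.v (e 2 - e 0) = Valued.v ϖ ^ k) (hloc : Valued.v (e 2 - e 1) = Valued.v ϖ ^ k)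
    (hout : (Valued.v (e 0) ≤ Valued.v ϖ ^ ℓ ∧ Valued.v (e 1) ≤ Valued.v ϖ ^ ℓ ∧ Valued.v (e 2) ≤ Valued.v ϖ ^ ℓ) ∧
      Valued.v (e 1 - e 0) ≤ Valued.v ϖ ^ (ℓ + ρ)) (hvac : ℓ + 2 * ρ ≤ k) {M : Submodule 𝒪[K] (Fin 3 → K)}
    (hM : M ∈ stratum σ ϖ T ![2 * ρ, 2 * ρ, 2 * ρ]) : LatticeInLevel ϖ ℓ (Matrix.diagonal e) M := by
  have hvσ : ∀ a, Valued.v (σ a) = Valued.v a := hD.2.1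
  have hϖ : Valued.v ϖ = exp (-1 : ℤ) := hD.2.2.1
  have hfix : ∀ x : K, σ x = x → x ≠ 0 → ∃ n : ℤ, Valued.v x = exp (2 * n) := hD.2.2.2.1
  obtain ⟨hϖ0, hϖ1⟩ := ne_zero_and_v_lt_one_of_v_eq_exp hϖ
  have hvϖ0 : Valued.v ϖ ≠ 0 := (Valuation.ne_zero_iff _).2 hϖ0
  rw [stratum_H_eq hvσ hfix hϖ T hρ] at hM
  obtain ⟨-, -, x, ζ, y'', hx, hζ, hy, -, rfl⟩ := hM
  have hge : Valued.v ((e 2 - e 1) / (e 2 - e 0)) = 1 := by rw [map_div₀, hk, hloc, div_self (pow_ne_zero k hvϖ0)]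
  have hκ : Valued.v (y'' / (x * ζ)) = 1 := by rw [map_div₀, map_mul, hx, hζ, mul_one, hy, div_one]
  exact (latticeInLevel_diagonal_latt_coreHanging_iff_onLocus hϖ ℓ ρ k e hk hloc hx hζ y'').2
    ⟨⟨hout, by omega⟩, tokenBall_unit_of_le hϖ1.le hvac hκ hge⟩

/-- **HEAD — IN THE VACUOUS REGIME THE LABELLED κ-WEIGHTED H SUM IS ★ κH's UNLABELLED VALUE** (any regime of the datum; `f₀` binder verbatim from ★
`finsum_kappaCount_mul_stabiliserWeight_hasAxis_H`). [cite: Kottwitz1986BaseChangeUnits, §1 pp. 240–241] [cite: LanglandsShelstad1987, §3] [cite: Rogawski1990, §4.9 Prop. 4.9.1 (a) p. 55] -/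
theorem finsum_kappaCount_mul_stabiliserWeight_stratum_H_sep_eq_of_vacuous (hD : IsRamifiedQuadraticDatum σ ϖ d t) (h2 : Valued.v (2 : K) < 1)
    (hE : IsElementDatum σ ϖ N₀ α β n₁ n₂ n₃) (hN₀ : d ≤ N₀) (hT : (T : Matrix (Fin 3) (Fin 3) K) = Matrix.diagonal ![α, β, 1]) (ρ : ℕ) (hρ : 1 ≤ ρ)
    (i : Fin 3) (f₀ : K) (hσf₀ : σ f₀ = f₀)
    (hf₀ : n₁ = n₂ → n₂ = n₃ → n₁ < 2 * ρ → 2 * ρ - n₁ ≤ n₁ - d + 1 → Valued.v (f₀ + (β - 1) / (α - 1)) ≤ Valued.v ϖ ^ (2 * ρ - n₁))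
    (ℓ k : ℕ) (e : Fin 3 → K) (hk : Valued.v (e 2 - e 0) = Valued.v ϖ ^ k) (hloc : Valued.v (e 2 - e 1) = Valued.v ϖ ^ k)
    (hout : (Valued.v (e 0) ≤ Valued.v ϖ ^ ℓ ∧ Valued.v (e 1) ≤ Valued.v ϖ ^ ℓ ∧ Valued.v (e 2) ≤ Valued.v ϖ ^ ℓ) ∧
      Valued.v (e 1 - e 0) ≤ Valued.v ϖ ^ (ℓ + ρ)) (hvac : ℓ + 2 * ρ ≤ k) :
    ∑ᶠ M ∈ {M | M ∈ stratum σ ϖ T ![2 * ρ, 2 * ρ, 2 * ρ] ∧ LatticeInLevel ϖ ℓ (Matrix.diagonal e) M},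
        (kappaCount σ ϖ 0 i M : ℚ) * stabiliserWeight σ M =
      if n₁ = n₂ ∧ n₂ = n₃ ∧ n₁ < 2 * ρ ∧ 2 * ρ - n₁ ≤ n₁ - d + 1 ∧ d ≤ (2 * ρ - n₁ + 1) / 2
      then (((![normSign σ (-(1 + f₀)), normSign σ f₀ * normSign σ (-(1 + f₀)), normSign σ f₀] : Fin 3 → ℤ) i : ℤ) : ℚ) *
             (Fintype.card 𝓀[K] : ℚ) ^ (2 * ρ - (2 * ρ - n₁ + 1) / 2)
      else 0 := by
  classical
  rw [finsum_mem_sep_eq_ite_of_forall_iff (stratum σ ϖ T ![2 * ρ, 2 * ρ, 2 * ρ]) _ True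
      (fun M hM => iff_true_intro (latticeInLevel_of_mem_stratum_H_of_vacuous hD T ρ hρ ℓ k e hk hloc hout hvac hM)) _, if_pos trivial,
    finsum_kappaCount_mul_stabiliserWeight_hasAxis_H hD h2 hE hN₀ hT ρ hρ i f₀ hσf₀ hf₀]

end Vacuous

end Summit.HodgeConjecture.HodgeConjecture.Cruxes.H413.F0P3cDyRamLabelledKappaCoreHangingLocus

end
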